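import Summits.ResolutionOfSingularities.ResolutionOfSingularities.Theorems.FrobeniusClosingSteerOddBranchLinearFactor
import HarnessLib

/-!
# Crux `Steer` (stmt-ResolutionOfSingularities-16345), chain W4.1, (Par-S) ARITH-REDUCTION — BRICK #2, part 2:
# the ON-AXIS transport `(u, m₁/u, m₂/u)` and the division `F/u^d ≡ Ψ(m₁/u, m₂/u) (mod u)` (Theses-free, def-free)

OURS (campaign `res-hironaka`, rung L ★L-G4, slot W4.1; statements about the route's own objects; they replace the
role of no printed item and are NOT statements of the manuscript under review [claim: Hironaka2017, status:
under-review]; AI review is weaker than expert review). Seat res-D-pv-003 (gen 6) on res-L0-w41-plan-1 RULING 115a /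
116e / 118c («pv-003 #2 = (R1) LEGALITY CRITERION»; criterion by res-L0-w41-tri-1 g5, TRIAGE v6.10). Part 1 is
`…FrobeniusClosingSteerOddBranchLinearFactor.lean` (§1 σ_top core, §2 homogeneous-form algebra, §3 `IsRsopPart` plumbing);
part 3 `…FrobeniusClosingSteerOddBranchResidueZero.lean` is the ASSEMBLY (§6/§6′); the split is the 400-line rule. See
part 1's header for the statement of (R1) and its use by the ARITH-REDUCTION word `StrippingTailSwitchingArithTwoN`
(res-L0-w41-strat-2 §σ2.28 (g); kernel hand res-type-062).

* §4 `isRsopPart_triple_excParam`, `isRsopPart_excParam_strictTransform₂`: with the centre of `O` ON THE AXIS of the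
  binary cone (`v(m₁), v(m₂) < v(u)`), `(u, m₁, m₂)` is part of a regular system of parameters of `S`, hence
  `(u, m₁/u, m₂/u)` of the transform `R` (the chain's HLOST 2.7 / de Jong 2.4 transport
  `exists_isRsopPart_quadraticTransform_rsopStep`, two fractions).
* §5 `div_pow_mem_and_sub_eval_mem`: `F ≡ Ψ(m₁, m₂) (mod 𝔪_S^{d+1})` ⇒ `F/u^d ∈ R` and `F/u^d ≡ Ψ(m₁/u, m₂/u) (mod u)`.
No Theses file is imported; nothing here is a route item or a registration. [cite: Matsumura1987, Thm. 14.2]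
[cite: DeJong1996, 2.4] [cite: HeinzerEtAl2015, Lemma 2.7] [cite: NovacoskiSpivakovsky2014, Def. 2.11]
-/

noncomputable section

-- `Summit.<S>.<S>.…` duplicates the summit name by design (single-problem summit).
set_option linter.dupNamespace false

open IsLocalRing MvPolynomial

namespace Summit.ResolutionOfSingularities.ResolutionOfSingularities.Theorems.SwitchingDichotomy.OddBranchParity

open Literature.AlgebraicGeometry.Resolution
open SigmaTopLegality

/-! ## §4 The ON-AXIS transport: `(u, m₁/u, m₂/u)` is part of a regular system of parameters of the transform -/

section Transport

variable {K : Type} [Field K] {O : ValuationSubring K} {S : Subring K} [IsRegularLocalRing S]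

/-- **`(u, m₁, m₂)` is part of a regular system of parameters of `S`** when `(m₁, m₂)` is, `u ∈ 𝔪_S` is non-zero of
maximal value and `v(m₁), v(m₂) < v(u)` (the centre direction lies on the axis of the binary cone): `u ∉ 𝔪_S² + (m₁, m₂)`
by values (`v` of `𝔪²` is `< v(u)`, res-type-062's `SwitchPlane.valuation_lt_of_mem_sq`). [cite: Matsumura1987, Thm. 14.2] -/
theorem isRsopPart_triple_excParam (hdom : SubringDominates S O.toSubring) {u : K} (huS : u ∈ S)
    (hum : (⟨u, huS⟩ : S) ∈ maximalIdeal S) (hu0 : u ≠ 0)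
    (humax : ∀ y : S, y ∈ maximalIdeal S → O.valuation (y : K) ≤ O.valuation u)
    {m₁ m₂ : S} (hm : IsRsopPart ![m₁, m₂]) (h₁ : O.valuation (m₁ : K) < O.valuation u)
    (h₂ : O.valuation (m₂ : K) < O.valuation u) : IsRsopPart ![(⟨u, huS⟩ : S), m₁, m₂] := by
  have hSO : S ≤ O.toSubring := hdom.1
  refine isRsopPart_cons_of_not_mem_sq_sup hm hum fun hmem => ?_
  obtain ⟨q, hq, w, hw, hqw⟩ := Submodule.mem_sup.mp hmem
  rw [Matrix.range_cons_cons_empty] at hw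
  obtain ⟨α, β, rfl⟩ := Ideal.mem_span_pair.mp hw
  have hvq : O.valuation (q : K) < O.valuation u :=
    SwitchPlane.valuation_lt_of_mem_sq hdom (π := ⟨u, huS⟩) hu0 humax hq
  have hvα : O.valuation (α : K) ≤ 1 := (O.valuation_le_one_iff _).mpr (hSO α.2)
  have hvβ : O.valuation (β : K) ≤ 1 := (O.valuation_le_one_iff _).mpr (hSO β.2)
  have hvw : O.valuation ((α * m₁ + β * m₂ : S) : K) < O.valuation u := by
    push_cast
    refine lt_of_le_of_lt (Valuation.map_add _ _ _) (max_lt ?_ ?_)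
    · rw [map_mul]
      calc O.valuation (α : K) * O.valuation (m₁ : K) ≤ 1 * O.valuation (m₁ : K) := mul_le_mul' hvα le_rfl
        _ < O.valuation u := by rw [one_mul]; exact h₁
    · rw [map_mul]
      calc O.valuation (β : K) * O.valuation (m₂ : K) ≤ 1 * O.valuation (m₂ : K) := mul_le_mul' hvβ le_rfl
        _ < O.valuation u := by rw [one_mul]; exact h₂
  have hsum : O.valuation u < O.valuation u := by
    have hu : (u : K) = (q : K) + ((α * m₁ + β * m₂ : S) : K) := by
      have := congrArg Subtype.val hqw
      simpa using this.symm
    calc O.valuation u = O.valuation ((q : K) + ((α * m₁ + β * m₂ : S) : K)) := by rw [← hu]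
      _ ≤ max (O.valuation (q : K)) (O.valuation ((α * m₁ + β * m₂ : S) : K)) := Valuation.map_add _ _ _
      _ < O.valuation u := max_lt hvq hvw
  exact lt_irrefl _ hsum

/-- **(P3c) `isRsopPart_excParam_strictTransform₂`** — the ON-AXIS transport. For the local blowing up `R` of the
regular local member `S` (dominated by `O`) along `𝔪_S` (a POINT step), an exceptional parameter `u` and a pair
`(m₁, m₂)` forming part of a regular system of parameters with `v(m₁), v(m₂) < v(u)` (the centre of `O` on `R` lies
on the AXIS `V(m₁/u, m₂/u)`): `(u, m₁/u, m₂/u)` is part of a regular system of parameters of `R` (the chain's HLOST 2.7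
/ de Jong 2.4 transport `exists_isRsopPart_quadraticTransform_rsopStep` with two fractions). [cite: DeJong1996, 2.4]
[cite: HeinzerEtAl2015, Lemma 2.7] [cite: NovacoskiSpivakovsky2014, Def. 2.11] -/
theorem isRsopPart_excParam_strictTransform₂ (hdom : SubringDominates S O.toSubring) {R : Subring K}
    (hbl : IsLocalBlowupAlong O S (maximalIdeal S) R) [IsLocalRing R] {u : K} (huS : u ∈ S)
    (hum : (⟨u, huS⟩ : S) ∈ maximalIdeal S) (hu0 : u ≠ 0)
    (humax : ∀ y : S, y ∈ maximalIdeal S → O.valuation (y : K) ≤ O.valuation u)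
    {m₁ m₂ : S} (hm : IsRsopPart ![m₁, m₂]) (h₁ : O.valuation (m₁ : K) < O.valuation u)
    (h₂ : O.valuation (m₂ : K) < O.valuation u) :
    ∃ (hu : u ∈ R) (hm₁ : (m₁ : K) / u ∈ R) (hm₂ : (m₂ : K) / u ∈ R),
      IsRsopPart ![(⟨u, hu⟩ : R), ⟨(m₁ : K) / u, hm₁⟩, ⟨(m₂ : K) / u, hm₂⟩] := by
  classical
  have hc : IsRsopPart ![(⟨u, huS⟩ : S), m₁, m₂] := isRsopPart_triple_excParam hdom huS hum hu0 humax hm h₁ h₂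
  obtain ⟨e, xf, hd, hxf, hxfz⟩ := hc.exists_rsop
  have hxf0 : xf (Fin.castAdd e 0) = ⟨u, huS⟩ := by rw [hxfz]; rfl
  have hxf1 : xf (Fin.castAdd e 1) = m₁ := by rw [hxfz]; rfl
  have hxf2 : xf (Fin.castAdd e 2) = m₂ := by rw [hxfz]; rfl
  have hi0 : ((xf (Fin.castAdd e 0) : S) : K) ≠ 0 := by rw [hxf0]; exact hu0
  have hmin : ∀ j, O.valuation ((xf j : S) : K) ≤ O.valuation ((xf (Fin.castAdd e 0) : S) : K) := by
    intro j
    rw [hxf0]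
    exact humax (xf j) (by rw [← hxf]; exact Ideal.subset_span ⟨j, rfl⟩)
  have hne1 : Fin.castAdd e (1 : Fin 3) ≠ Fin.castAdd e 0 := fun h =>
    absurd (Fin.castAdd_injective _ _ h) (by decide)
  have hne2 : Fin.castAdd e (2 : Fin 3) ≠ Fin.castAdd e 0 := fun h =>
    absurd (Fin.castAdd_injective _ _ h) (by decide)
  let jJ : Fin 2 → {j : Fin (3 + e) // j ≠ Fin.castAdd e 0} := ![⟨Fin.castAdd e 1, hne1⟩, ⟨Fin.castAdd e 2, hne2⟩]
  have hjJ : Function.Injective jJ := by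
    intro a b hab
    fin_cases a <;> fin_cases b
    · rfl
    · exact absurd (Fin.castAdd_injective _ _ (congrArg (fun t : {j : Fin (3 + e) // j ≠ Fin.castAdd e 0} => t.1) hab))
        (by decide)
    · exact absurd (Fin.castAdd_injective _ _ (congrArg (fun t : {j : Fin (3 + e) // j ≠ Fin.castAdd e 0} => t.1) hab))
        (by decide)
    · rfl
  have hv0 : 0 < O.valuation u := pos_iff_ne_zero.mpr ((Valuation.ne_zero_iff _).mpr hu0)
  have hJ : ∀ k, O.valuation (((xf (jJ k).1 : S) : K) / ((xf (Fin.castAdd e 0) : S) : K)) < 1 := by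
    intro k
    fin_cases k
    · change O.valuation (((xf (Fin.castAdd e 1) : S) : K) / ((xf (Fin.castAdd e 0) : S) : K)) < 1
      rw [hxf0, hxf1, map_div₀, div_lt_one₀ hv0]
      exact h₁
    · change O.valuation (((xf (Fin.castAdd e 2) : S) : K) / ((xf (Fin.castAdd e 0) : S) : K)) < 1
      rw [hxf0, hxf2, map_div₀, div_lt_one₀ hv0]
      exact h₂
  have hR : R = locAtCentre (blowupRing S ((xf (Fin.castAdd e 0) : S) : K)) O := by
    rw [hxf0]
    exact DivisorTrigger.eq_locAtCentre_blowupRing hbl huS hum hu0 humax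
  obtain ⟨z₁, hz₁, hz₁0, hz₁s⟩ :=
    exists_isRsopPart_quadraticTransform_rsopStep S O hdom hd xf hxf (Fin.castAdd e 0) hi0 hmin jJ hjJ hJ R hR
  rw [hxf0] at hz₁0
  change ((z₁ 0 : R) : K) = u at hz₁0
  have hz₁1 : ((z₁ 1 : R) : K) = (m₁ : K) / u := by
    have h := hz₁s 0
    rw [hxf0] at h
    change ((z₁ (Fin.succ 0) : R) : K) = ((xf (Fin.castAdd e 1) : S) : K) / u at h
    rw [hxf1] at h
    exact h
  have hz₁2 : ((z₁ 2 : R) : K) = (m₂ : K) / u := by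
    have h := hz₁s 1
    rw [hxf0] at h
    change ((z₁ (Fin.succ 1) : R) : K) = ((xf (Fin.castAdd e 2) : S) : K) / u at h
    rw [hxf2] at h
    exact h
  have hu : u ∈ R := by rw [← hz₁0]; exact (z₁ 0).2
  have hm₁ : (m₁ : K) / u ∈ R := by rw [← hz₁1]; exact (z₁ 1).2
  have hm₂ : (m₂ : K) / u ∈ R := by rw [← hz₁2]; exact (z₁ 2).2
  have heq : (![(⟨u, hu⟩ : R), ⟨(m₁ : K) / u, hm₁⟩, ⟨(m₂ : K) / u, hm₂⟩] : Fin 3 → R) = z₁ := by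
    funext j
    fin_cases j
    · exact Subtype.ext hz₁0.symm
    · exact Subtype.ext hz₁1.symm
    · exact Subtype.ext hz₁2.symm
  exact ⟨hu, hm₁, hm₂, heq ▸ hz₁⟩

end Transport

/-! ## §5 Division: the cleaned radicand over `u^d` is congruent to the dehomogenised cone modulo `u` -/

section Division

variable {K : Type} [Field K] {O : ValuationSubring K} {S : Subring K}

/-- Coercion of a polynomial value along a subring inclusion. [folklore] -/
theorem coe_eval_map_inclusion {R : Subring K} (hle : S ≤ R) (Ψ : MvPolynomial (Fin 2) S) (x : Fin 2 → R) :
    ((eval x (map (Subring.inclusion hle) Ψ) : R) : K) = eval₂ S.subtype (fun i => ((x i : R) : K)) Ψ := by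
  rw [MvPolynomial.eval_map]
  change R.subtype (eval₂ (Subring.inclusion hle) x Ψ) = _
  rw [MvPolynomial.hom_eval₂]
  rfl

/-- Coercion of a polynomial value of `S` to `K`. [folklore] -/
theorem coe_eval {σ : Type*} (Ψ : MvPolynomial σ S) (x : σ → S) :
    ((eval x Ψ : S) : K) = eval₂ S.subtype (fun i => ((x i : S) : K)) Ψ := by
  change S.subtype (eval₂ (RingHom.id S) x Ψ) = _
  rw [MvPolynomial.eval₂_comp_left]
  rfl

/-- Dehomogenisation in `K`: `Ψ(m₁/u, m₂/u) = Ψ(m₁, m₂) / u^d` for `Ψ` homogeneous of degree `d`. [folklore] -/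
theorem eval₂_div_eq {d : ℕ} (Ψ : MvPolynomial (Fin 2) S) (hΨ : Ψ.IsHomogeneous d) (m₁ m₂ u : K) :
    eval₂ S.subtype ![m₁ / u, m₂ / u] Ψ = eval₂ S.subtype ![m₁, m₂] Ψ / u ^ d := by
  have hK : (map S.subtype Ψ).IsHomogeneous d := hΨ.map _
  have h1 : eval₂ S.subtype ![m₁ / u, m₂ / u] Ψ = eval (fun i => u⁻¹ * ![m₁, m₂] i) (map S.subtype Ψ) := by
    rw [MvPolynomial.eval_map]
    congr 1
    funext i
    fin_cases i
    · change m₁ / u = u⁻¹ * m₁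
      rw [div_eq_inv_mul]
    · change m₂ / u = u⁻¹ * m₂
      rw [div_eq_inv_mul]
  rw [h1, IsHomogeneous.eval_mul_left hK, MvPolynomial.eval_map, inv_pow, div_eq_inv_mul]

variable [IsLocalRing S]

/-- **Division.** For a point step `S → R` with exceptional parameter `u`, a form `Ψ` homogeneous of degree `d`
over `S`, `m₁, m₂ ∈ 𝔪_S` and `F ≡ Ψ(m₁, m₂) (mod 𝔪_S^{d+1})`: `F/u^d ∈ R` and
`F/u^d ≡ Ψ(m₁/u, m₂/u) (mod u·R)`. [cite: NovacoskiSpivakovsky2014, Def. 2.11] -/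
theorem div_pow_mem_and_sub_eval_mem {R : Subring K} (hbl : IsLocalBlowupAlong O S (maximalIdeal S) R) {u : K}
    (huS : u ∈ S) (hum : (⟨u, huS⟩ : S) ∈ maximalIdeal S) (hu0 : u ≠ 0)
    (humax : ∀ y : S, y ∈ maximalIdeal S → O.valuation (y : K) ≤ O.valuation u)
    {d : ℕ} (Ψ : MvPolynomial (Fin 2) S) (hΨ : Ψ.IsHomogeneous d) {m₁ m₂ : S} (hm₁ : m₁ ∈ maximalIdeal S)
    (hm₂ : m₂ ∈ maximalIdeal S) {F : S} (hF : F - eval ![m₁, m₂] Ψ ∈ maximalIdeal S ^ (d + 1)) :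
    ∃ (hG : (F : K) / u ^ d ∈ R) (h₁ : (m₁ : K) / u ∈ R) (h₂ : (m₂ : K) / u ∈ R),
      (⟨(F : K) / u ^ d, hG⟩ : R) -
          eval ![⟨(m₁ : K) / u, h₁⟩, ⟨(m₂ : K) / u, h₂⟩] (map (Subring.inclusion hbl.isLocalBlowup.le) Ψ) ∈
        Ideal.span {(⟨u, hbl.isLocalBlowup.le huS⟩ : R)} := by
  have hle : S ≤ R := hbl.isLocalBlowup.le
  have hR : R = locAtCentre (blowupRing S u) O := DivisorTrigger.eq_locAtCentre_blowupRing hbl huS hum hu0 humax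
  have hbR : blowupRing S u ≤ R := hR ▸ le_locAtCentre _ O
  -- `Ψ(m₁, m₂) ∈ 𝔪^d`, hence `F ∈ 𝔪^d`
  have hev : eval ![m₁, m₂] Ψ ∈ maximalIdeal S ^ d := by
    refine IsHomogeneous.eval_mem_pow hΨ fun i => ?_
    fin_cases i
    · exact hm₁
    · exact hm₂
  have hFd : F ∈ maximalIdeal S ^ d := by
    have : F = (F - eval ![m₁, m₂] Ψ) + eval ![m₁, m₂] Ψ := by ring
    rw [this]
    exact Ideal.add_mem _ (Ideal.pow_le_pow_right (Nat.le_succ d) hF) hev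
  have hG : (F : K) / u ^ d ∈ R := hbR (QuadraticStep.div_pow_mem_blowupRing (⟨u, huS⟩ : S) hFd)
  have hE : (((F - eval ![m₁, m₂] Ψ : S) : K)) / u ^ (d + 1) ∈ R :=
    hbR (QuadraticStep.div_pow_mem_blowupRing (⟨u, huS⟩ : S) hF)
  have h₁ : (m₁ : K) / u ∈ R := hbR (div_mem_blowupRing u hm₁)
  have h₂ : (m₂ : K) / u ∈ R := hbR (div_mem_blowupRing u hm₂)
  refine ⟨hG, h₁, h₂, ?_⟩
  refine Ideal.mem_span_singleton'.mpr ⟨⟨_, hE⟩, Subtype.ext ?_⟩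
  change (((F - eval ![m₁, m₂] Ψ : S) : K)) / u ^ (d + 1) * u =
    (F : K) / u ^ d - ((eval ![(⟨(m₁ : K) / u, h₁⟩ : R), ⟨(m₂ : K) / u, h₂⟩]
      (map (Subring.inclusion hle) Ψ) : R) : K)
  rw [coe_eval_map_inclusion hle Ψ]
  have hev' : (fun i => (((![(⟨(m₁ : K) / u, h₁⟩ : R), ⟨(m₂ : K) / u, h₂⟩] i : R) : K))) = ![(m₁ : K) / u, (m₂ : K) / u] := by
    funext i
    fin_cases i <;> rfl
  rw [hev', eval₂_div_eq Ψ hΨ _ _ u]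
  have hx : (fun i => ((![m₁, m₂] i : S) : K)) = ![(m₁ : K), (m₂ : K)] := by
    funext i
    fin_cases i <;> rfl
  have hcoe : (((F - eval ![m₁, m₂] Ψ : S) : K)) = (F : K) - eval₂ S.subtype ![(m₁ : K), (m₂ : K)] Ψ := by
    push_cast
    rw [coe_eval, hx]
  rw [hcoe]
  have hud : (u : K) ^ d ≠ 0 := pow_ne_zero d hu0
  field_simp
  ring

end Division


end Summit.ResolutionOfSingularities.ResolutionOfSingularities.Theorems.SwitchingDichotomy.OddBranchParity

end
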